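import Literature.Probability.RandomPlanarGeometry.LoewnerImageStepResidue
import Literature.Analysis.Complex.CauchyTaylorBall
import HarnessLib

/-!
# One step of the conformal image of a Loewner chain, V: the first-order expansion at points far from the tip

Sequel to `LoewnerImageStep`, `LoewnerImageStepCircle`, `LoewnerImageStepResidue` (notation there:
`B ∈ 𝒬*` missing `B(0, 8ρ₀)`, `h = hmap Φ = E_B − L`, the increment driver `U` run for time `u`
with size `η = stepSize S u ≤ dρ₀/1000`, the slid hull `B'`, `h' = hmapT Φ' (U_u)`), after

* G. F. Lawler, O. Schramm, W. Werner, *Conformal restriction: the chordal case*, J. Amer. Math.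
  Soc. **16** (2003) 917–955 (**[LSW]**), §5 (5.1):
  `∂_t h_t(z) = 2 h_t'(W_t)²/(h_t(z) − h_t(W_t)) − 2 h_t'(z)/(z − W_t)`, a formula valid at EVERY
  point `z` of the domain, and §8.4, proof of Lemma 8.9, where it is used at the force point:
  `d[h_t(O_t)] = 2h_t'(W_t)² dt/(h_t(O_t) − h_t(W_t))`,
  `d[h_t'(O_t)] = (2h_t'(O_t)/(O_t − W_t)² − 2h_t'(W_t)² h_t'(O_t)/(h_t(O_t) − h_t(W_t))²) dt`;
* G. F. Lawler, *Conformally Invariant Processes in the Plane* (2005), §4.6.1, Prop. 4.40.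

`LoewnerImageStepResidue` proves the one-step form of (5.1), `h'(z) − h(z) = 2u D(z) + O(u(η + u))`
with `D(z) = d²/E_B(z) − E_B'(z)/z`, for `|z| ≤ ρ₀/4` only (both terms of `D` have poles at the
tip `0`, and the proof integrates the circle identity over `|ζ| = ρ₀`). For the martingale of
[LSW] Lemma 8.9 the same expansion is needed at the force point `O_t`, at distance `Z_t = W_t − O_t`
from the tip, which is NOT small. This file proves it at points FAR from the tip, where the
argument is in fact simpler (no pole): for a real centre `x₀` with `|x₀| ≥ ρ₀/8`, `B(x₀, ρ₀) ∩ B = ∅`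
and a lower bound `|E_B| ≥ m₀ ≥ 8η` on `B(x₀, 3r₁)` (`0 < r₁ ≤ ρ₀/48`),

* `norm_sub_hmap_far_le` — the pointwise identity
  `|[h'(ζ) − h(ζ)] − [a/E_B(ζ) − E_{B'}'(ζ − U_u)·2u/ζ]| ≤ 60 d u η/m₀² + 2048 u η/ρ₀² + 196608 u²/ρ₀³`
  on `B(x₀, 3r₁)` (hydrodynamic expansion of `φ` at `w = h(ζ)`, conjugation `φ(h ζ) = h'(g ζ)`,
  Taylor for `h'`, `g ζ − ζ = 2u/ζ + O(uη/ρ₀²)` — exactly as on the circle, with the Koebe bound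
  replaced by the hypothesis `|E_B| ≥ m₀`);
* `norm_hmapT_sub_hmap_far_le`, `norm_deriv_hmapT_sub_hmap_far_le` — `|h' − h| ≤ K u` on
  `B(x₀, 3r₁)` and `|(h' − h)'| ≤ 2Ku/r₁` on `closedBall x₀ (2r₁)` (Cauchy);
* **`norm_hmapT_sub_hmap_sub_far_le`** — `|h'(ζ) − h(ζ) − 2u (d²/E_B(ζ) − E_B'(ζ)/ζ)| ≤ u (C₁ η + C₂ u)`
  on `closedBall x₀ r₁`, with explicit `C₁ = farC₁ d ρ₀ m₀`, `C₂ = farC₂ d ρ₀ m₀ r₁` (feed back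
  `a = 2ud² + O(u(η+u))`, `E_{B'}'(ζ − U_u) = E_B'(ζ) + (h' − h)'(ζ)`);
* `norm_deriv_hmapT_sub_hmap_sub_far_le` — the same for the derivative at `x₀` (Cauchy on
  `ball x₀ r₁`), the one-step form of the displayed `d[h_t'(O_t)]`.

## References

* [LSW] §5 (5.1)–(5.2), §8.4 proof of Lemma 8.9. [LawlerSchrammWerner2003Restriction]
* Lawler (2005), §4.6.1, Prop. 4.40. [Lawler2005]
-/

noncomputable section

open Set Filter Metric Bornology Function
open _root_.Complex _root_.Topology _root_.Real
open UpperHalfPlane (upperHalfPlaneSet isOpen_upperHalfPlaneSet)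
open Literature.Analysis.Complex (IsHydrodynamicAt hcapAt norm_deriv_le_of_forall_mem_ball)
open scoped ComplexConjugate NNReal

namespace Literature.Probability.RandomPlanarGeometry

namespace Loewner

variable {B : Set ℂ} {Φ : ConformalEquiv (upperHalfPlaneSet \ B) upperHalfPlaneSet} {d ρ₀ : ℝ}
  {U : ℝ≥0 → ℝ} {u : ℝ≥0} {S : ℝ}
  {Φ' : ConformalEquiv (upperHalfPlaneSet \ slidHull U B u) upperHalfPlaneSet}
  {x₀ r₁ m₀ : ℝ}
variable (hB : IsStarHull B) (hΦ : IsRestrictionMap B Φ) (hd : HasRestrictionDeriv B Φ d)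
  (hU : Continuous U) (hU0 : U 0 = 0) (hu : 0 < u) (hS : ∀ v : ℝ≥0, v ≤ u → |U v| ≤ S)
  (hρ₀ : 0 < ρ₀) (hBρ : Disjoint (ball (0 : ℂ) (8 * ρ₀)) B)
  (hη : stepSize S u ≤ d * ρ₀ / 1000)
  (hΦ' : IsRestrictionMap (slidHull U B u) Φ')
  (hr₁ : 0 < r₁) (hr₁' : r₁ ≤ ρ₀ / 48) (hx₀ : ρ₀ / 8 ≤ |x₀|)
  (hBx : Disjoint (ball (x₀ : ℂ) ρ₀) B)
  (hm₀ : ∀ z ∈ ball (x₀ : ℂ) (3 * r₁), m₀ ≤ ‖hullExt Φ z‖) (hm₀η : 8 * stepSize S u ≤ m₀)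

/-! ### Geometry far from the tip -/

include hU hu hS hBρ hη hB hΦ hd hρ₀ in
/-- **The slid hull is within `η` of the hull**: every point of `B'` is `g_u(b) − U_u` with `b ∈ B`,
`|g_u(b) − b| ≤ √u`, `|U_u| ≤ S`. [cite: Lawler2005, Lemma 4.13] -/
theorem exists_mem_norm_sub_le_of_mem_slidHull {w : ℂ} (hw : w ∈ slidHull U B u) :
    ∃ b ∈ B, ‖w - b‖ ≤ stepSize S u := by
  obtain ⟨-, -, -, hη1, -⟩ := stepSize_small hB hΦ hd hu hS hρ₀ hη
  obtain ⟨b, hb, rfl⟩ := hw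
  refine ⟨b, hb, ?_⟩
  have hmove := (alive_of_mem hU hu hS hBρ (by linarith) hb).2
  have hUu : |U u| ≤ S := hS u le_rfl
  have h4 : Real.sqrt u ≤ 4 * Real.sqrt u := by linarith [Real.sqrt_nonneg (u : ℝ)]
  calc ‖map U u b - U u - b‖ = ‖(map U u b - b) - (U u : ℂ)‖ := by ring_nf
    _ ≤ ‖map U u b - b‖ + ‖((U u : ℝ) : ℂ)‖ := norm_sub_le _ _
    _ ≤ Real.sqrt u + S := by rw [norm_real, Real.norm_eq_abs]; exact add_le_add hmove hUu
    _ ≤ stepSize S u := by rw [stepSize]; linarith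

include hB hΦ hd hU hu hS hρ₀ hBρ hη hBx in
/-- **`B(x₀, ρ₀/2) ∩ B' = ∅`** when `B(x₀, ρ₀) ∩ B = ∅`. [folklore] -/
theorem disjoint_ball_slidHull_far : Disjoint (ball (x₀ : ℂ) (ρ₀ / 2)) (slidHull U B u) := by
  obtain ⟨-, -, -, hη1, -⟩ := stepSize_small hB hΦ hd hu hS hρ₀ hη
  refine Set.disjoint_left.2 fun w hw hwB ↦ ?_
  obtain ⟨b, hb, hwb⟩ := exists_mem_norm_sub_le_of_mem_slidHull hB hΦ hd hU hu hS hρ₀ hBρ hη hwB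
  refine Set.disjoint_left.1 hBx (show b ∈ ball (x₀ : ℂ) ρ₀ from ?_) hb
  rw [mem_ball, dist_eq_norm] at hw ⊢
  calc ‖b - x₀‖ = ‖(w - x₀) - (w - b)‖ := by ring_nf
    _ ≤ ‖w - x₀‖ + ‖w - b‖ := norm_sub_le _ _
    _ < ρ₀ / 2 + stepSize S u := add_lt_add_of_lt_of_le hw hwb
    _ ≤ ρ₀ := by linarith

include hx₀ in
/-- Points of `B(x₀, ρ₀/16)` have norm `≥ ρ₀/16`. [folklore] -/
theorem norm_ge_of_mem_ball_far {z : ℂ} (hz : z ∈ ball (x₀ : ℂ) (ρ₀ / 16)) : ρ₀ / 16 ≤ ‖z‖ := by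
  rw [mem_ball, dist_eq_norm] at hz
  have h1 : ‖(x₀ : ℂ)‖ = |x₀| := by rw [norm_real, Real.norm_eq_abs]
  have := norm_sub_norm_le (x₀ : ℂ) z
  rw [h1, norm_sub_rev] at this
  linarith

include hr₁' in
/-- `B(x₀, 3r₁) ⊆ B(x₀, ρ₀/16)`. [folklore] -/
theorem ball_three_subset : ball (x₀ : ℂ) (3 * r₁) ⊆ ball (x₀ : ℂ) (ρ₀ / 16) :=
  ball_subset_ball (by linarith)

include hB hΦ hBx in
/-- `E_B` is holomorphic on `B(x₀, ρ₀)` (inside the symmetric domain) and `|E_B'| ≤ 2` on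
`B(x₀, ρ₀/2)`. [folklore] -/
theorem differentiableOn_hullExt_far : ball (x₀ : ℂ) ρ₀ ⊆ symmDomain B ∧
    DifferentiableOn ℂ (hullExt Φ) (ball (x₀ : ℂ) ρ₀) ∧
    ∀ z ∈ ball (x₀ : ℂ) (ρ₀ / 2), ‖deriv (hullExt Φ) z‖ ≤ 2 := by
  have hsub : ball (x₀ : ℂ) ρ₀ ⊆ symmDomain B := ball_subset_symmDomain hBx
  exact ⟨hsub, (differentiableOn_hullExt hB.isBoundedHull hΦ).mono hsub,
    fun z hz ↦ norm_deriv_hullExt_le_two hB.isBoundedHull hΦ hBx hz⟩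

include hB hΦ hd hU hU0 hu hS hρ₀ hBρ hη hΦ' hBx in
/-- `E_{B'}` is holomorphic on `B(x₀, ρ₀/2)` with `|E_{B'}'| ≤ 2` on `B(x₀, ρ₀/4)` and
`|E_{B'}''| ≤ 48/ρ₀` on `B(x₀, ρ₀/6)`. [folklore] -/
theorem differentiableOn_hullExt_slid_far : ball (x₀ : ℂ) (ρ₀ / 2) ⊆ symmDomain (slidHull U B u) ∧
    DifferentiableOn ℂ (hullExt Φ') (ball (x₀ : ℂ) (ρ₀ / 2)) ∧
    (∀ z ∈ ball (x₀ : ℂ) (ρ₀ / 4), ‖deriv (hullExt Φ') z‖ ≤ 2) ∧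
    ∀ z ∈ ball (x₀ : ℂ) (ρ₀ / 6), ‖deriv (deriv (hullExt Φ')) z‖ ≤ 48 / ρ₀ := by
  obtain ⟨-, -, -, hη1, -⟩ := stepSize_small hB hΦ hd hu hS hρ₀ hη
  have hB' := isStarHull_slidHull_step hB hU hU0 hS hρ₀ hBρ (by linarith)
  have hdisj := disjoint_ball_slidHull_far hB hΦ hd hU hu hS hρ₀ hBρ hη hBx
  have hsub : ball (x₀ : ℂ) (ρ₀ / 2) ⊆ symmDomain (slidHull U B u) := ball_subset_symmDomain hdisj
  have hdiff : DifferentiableOn ℂ (hullExt Φ') (ball (x₀ : ℂ) (ρ₀ / 2)) :=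
    (differentiableOn_hullExt hB'.isBoundedHull hΦ').mono hsub
  have hD1 : ∀ z ∈ ball (x₀ : ℂ) (ρ₀ / 4), ‖deriv (hullExt Φ') z‖ ≤ 2 := fun z hz ↦
    norm_deriv_hullExt_le_two hB'.isBoundedHull hΦ' hdisj (by simpa [show ρ₀ / 2 / 2 = ρ₀ / 4 by ring] using hz)
  refine ⟨hsub, hdiff, hD1, fun z hz ↦ ?_⟩
  -- Cauchy for `E_{B'}'` on `ball z (ρ₀/12) ⊆ ball x₀ (ρ₀/4)`
  have hzsub : ball z (ρ₀ / 12) ⊆ ball (x₀ : ℂ) (ρ₀ / 4) := by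
    intro w hw
    rw [mem_ball] at hz hw ⊢
    linarith [dist_triangle w z x₀]
  have hd' : DifferentiableOn ℂ (deriv (hullExt Φ')) (ball z (ρ₀ / 12)) :=
    (((hdiff.analyticOnNhd isOpen_ball).deriv).differentiableOn).mono (hzsub.trans (ball_subset_ball (by linarith)))
  have h := norm_deriv_le_of_forall_mem_ball (f := deriv (hullExt Φ')) (c := z) (by positivity : 0 < ρ₀ / 12) hd'
    fun w hw ↦ hD1 w (hzsub hw)
  refine h.trans (le_of_eq ?_); field_simp; ring

include hB hΦ hd hU hU0 hu hS hρ₀ hBρ hη hΦ' hBx in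
/-- `h'` has derivative `E_{B'}'(y − U_u)` at points `y` of `B(x₀, ρ₀/4)` (then
`y − U_u ∈ B(x₀, ρ₀/2)`). [folklore] -/
theorem hasDerivAt_hmapT_far {y : ℂ} (hy : y ∈ ball (x₀ : ℂ) (ρ₀ / 4)) :
    HasDerivAt (hmapT Φ' (U u)) (deriv (hullExt Φ') (y - U u)) y := by
  obtain ⟨-, hdiff, -, -⟩ := differentiableOn_hullExt_slid_far hB hΦ hd hU hU0 hu hS hρ₀ hBρ hη hΦ' hBx
  obtain ⟨-, -, hη0, hη1, -⟩ := stepSize_small hB hΦ hd hu hS hρ₀ hη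
  have hUu : |U u| ≤ stepSize S u := by
    have := hS u le_rfl; rw [stepSize]; have := Real.sqrt_nonneg (u : ℝ); linarith
  have hyU : y - U u ∈ ball (x₀ : ℂ) (ρ₀ / 2) := by
    rw [mem_ball, dist_eq_norm] at hy ⊢
    calc ‖y - U u - x₀‖ = ‖(y - x₀) - (U u : ℂ)‖ := by ring_nf
      _ ≤ ‖y - x₀‖ + ‖((U u : ℝ) : ℂ)‖ := norm_sub_le _ _
      _ < ρ₀ / 4 + ρ₀ / 4 := by
          rw [norm_real, Real.norm_eq_abs]; exact add_lt_add_of_lt_of_le hy (by linarith)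
      _ = ρ₀ / 2 := by ring
  have h1 : HasDerivAt (hullExt Φ') (deriv (hullExt Φ') (y - U u)) (y - U u) :=
    (hdiff.differentiableAt (isOpen_ball.mem_nhds hyU)).hasDerivAt
  have h2 : HasDerivAt (fun z : ℂ ↦ hullExt Φ' (z - U u)) (deriv (hullExt Φ') (y - U u)) y := by
    simpa using h1.comp_sub_const y (U u : ℂ)
  exact (h2.sub_const _).add_const _

include hB hΦ hd hU hU0 hu hS hρ₀ hBρ hη hΦ' hBx in
/-- **Taylor for `h'` far from the tip**: `|h'(y) − h'(ζ) − h''(ζ)(y − ζ)| ≤ (48/ρ₀)|y − ζ|²` for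
`ζ ∈ B(x₀, ρ₀/16)` and `|y − ζ| ≤ ρ₀/16`. [folklore] -/
theorem norm_hmapT_taylor_far_le {ζ y : ℂ} (hζ : ζ ∈ ball (x₀ : ℂ) (ρ₀ / 16)) (hy : ‖y - ζ‖ ≤ ρ₀ / 16) :
    ‖hmapT Φ' (U u) y - hmapT Φ' (U u) ζ - deriv (hullExt Φ') (ζ - U u) * (y - ζ)‖ ≤
      48 / ρ₀ * ‖y - ζ‖ ^ 2 := by
  obtain ⟨-, hdiff, -, hD2⟩ := differentiableOn_hullExt_slid_far hB hΦ hd hU hU0 hu hS hρ₀ hBρ hη hΦ' hBx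
  obtain ⟨-, -, hη0, hη1, -⟩ := stepSize_small hB hΦ hd hu hS hρ₀ hη
  have hUu : |U u| ≤ stepSize S u := by
    have := hS u le_rfl; rw [stepSize]; have := Real.sqrt_nonneg (u : ℝ); linarith
  set s : Set ℂ := closedBall ζ ‖y - ζ‖ with hs
  have hsconv : Convex ℝ s := convex_closedBall _ _
  have hζs : ζ ∈ s := mem_closedBall_self (norm_nonneg _)
  have hys : y ∈ s := by rw [hs, mem_closedBall, dist_eq_norm]
  have hζx : ‖ζ - x₀‖ < ρ₀ / 16 := by rwa [mem_ball, dist_eq_norm] at hζ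
  have hs4 : ∀ w ∈ s, w ∈ ball (x₀ : ℂ) (ρ₀ / 4) := fun w hw ↦ by
    rw [hs, mem_closedBall, dist_eq_norm] at hw
    rw [mem_ball, dist_eq_norm]
    calc ‖w - x₀‖ = ‖(w - ζ) + (ζ - x₀)‖ := by ring_nf
      _ ≤ ‖w - ζ‖ + ‖ζ - x₀‖ := norm_add_le _ _
      _ < ρ₀ / 16 + ρ₀ / 16 := add_lt_add_of_le_of_lt (hw.trans hy) hζx
      _ ≤ ρ₀ / 4 := by linarith
  have hs8 : ∀ w ∈ s, w - U u ∈ ball (x₀ : ℂ) (ρ₀ / 6) := fun w hw ↦ by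
    rw [hs, mem_closedBall, dist_eq_norm] at hw
    rw [mem_ball, dist_eq_norm]
    calc ‖w - U u - x₀‖ = ‖(w - ζ) + (ζ - x₀) - (U u : ℂ)‖ := by ring_nf
      _ ≤ ‖(w - ζ) + (ζ - x₀)‖ + ‖((U u : ℝ) : ℂ)‖ := norm_sub_le _ _
      _ ≤ ‖w - ζ‖ + ‖ζ - x₀‖ + ‖((U u : ℝ) : ℂ)‖ := by linarith [norm_add_le (w - ζ) (ζ - x₀)]
      _ < ρ₀ / 16 + ρ₀ / 16 + ρ₀ / 1000 := by
          rw [norm_real, Real.norm_eq_abs]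
          linarith [hw.trans hy]
      _ ≤ ρ₀ / 6 := by linarith
  set D1 : ℂ → ℂ := fun w ↦ deriv (hullExt Φ') (w - U u) with hD1
  have hder : ∀ w ∈ s, HasDerivAt (hmapT Φ' (U u)) (D1 w) w := fun w hw ↦
    hasDerivAt_hmapT_far hB hΦ hd hU hU0 hu hS hρ₀ hBρ hη hΦ' hBx (hs4 w hw)
  have hd' : DifferentiableOn ℂ (deriv (hullExt Φ')) (ball (x₀ : ℂ) (ρ₀ / 2)) :=
    ((hdiff.analyticOnNhd isOpen_ball).deriv).differentiableOn
  have hD1der : ∀ w ∈ s, HasDerivAt D1 (deriv (deriv (hullExt Φ')) (w - U u)) w := fun w hw ↦ by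
    have hw2 : w - U u ∈ ball (x₀ : ℂ) (ρ₀ / 2) := ball_subset_ball (by linarith) (hs8 w hw)
    exact ((hd'.differentiableAt (isOpen_ball.mem_nhds hw2)).hasDerivAt).comp_sub_const w (U u : ℂ)
  have hD1bd : ∀ w ∈ s, ‖D1 w - D1 ζ‖ ≤ 48 / ρ₀ * ‖y - ζ‖ := fun w hw ↦ by
    have := hsconv.norm_image_sub_le_of_norm_deriv_le (f := D1) (C := 48 / ρ₀)
      (fun w hw ↦ (hD1der w hw).differentiableAt)
      (fun w hw ↦ by rw [(hD1der w hw).deriv]; exact hD2 _ (hs8 w hw))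
      hζs hw
    refine this.trans (mul_le_mul_of_nonneg_left ?_ (by positivity))
    rw [hs, mem_closedBall, dist_eq_norm] at hw; exact hw
  set G : ℂ → ℂ := fun w ↦ hmapT Φ' (U u) w - D1 ζ * w with hG
  have hGder : ∀ w ∈ s, HasDerivAt G (D1 w - D1 ζ) w := fun w hw ↦ by
    have := (hder w hw).sub ((hasDerivAt_id w).const_mul (D1 ζ))
    rw [mul_one] at this
    exact this
  have hMVT := hsconv.norm_image_sub_le_of_norm_deriv_le (f := G) (C := 48 / ρ₀ * ‖y - ζ‖)
    (fun w hw ↦ (hGder w hw).differentiableAt)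
    (fun w hw ↦ by rw [(hGder w hw).deriv]; exact hD1bd w hw) hζs hys
  have hrew : G y - G ζ = hmapT Φ' (U u) y - hmapT Φ' (U u) ζ - deriv (hullExt Φ') (ζ - U u) * (y - ζ) := by
    simp only [hG, hD1]; ring
  rw [hrew] at hMVT
  calc _ ≤ 48 / ρ₀ * ‖y - ζ‖ * ‖y - ζ‖ := hMVT
    _ = 48 / ρ₀ * ‖y - ζ‖ ^ 2 := by ring

/-! ### The conjugation identity far from the tip -/

include hB hΦ hd hU hU0 hu hS hρ₀ hBρ hη hΦ' hr₁' hx₀ hBx hm₀ hm₀η in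
/-- **`φ(h(ζ)) = h'(g(ζ))` on `B(x₀, 3r₁)`** (the three cases of `LoewnerImageStep`; the size
condition `|E_B(ζ)| > 2η` comes from `m₀ ≥ 8η`). [cite: Lawler2005, §4.6.1 (Φ_t ∘ g_{s,t} = g*_{s,t} ∘ Φ_s)] -/
theorem phiStep_hmap_far {ζ : ℂ} (hζ : ζ ∈ ball (x₀ : ℂ) (3 * r₁)) :
    phiStep Φ Φ' (2 * stepSize S u) (hmap Φ ζ) = hmapT Φ' (U u) (map U u ζ) := by
  obtain ⟨hd0, hd1, hη0, hη1, -⟩ := stepSize_small hB hΦ hd hu hS hρ₀ hη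
  have hη' : stepSize S u ≤ ρ₀ := by linarith
  obtain ⟨hsymm, -, -⟩ := differentiableOn_hullExt_far hB hΦ hBx
  have hζ16 := ball_three_subset hr₁' hζ
  have hζn := norm_ge_of_mem_ball_far hx₀ hζ16
  have hζΩ : ζ ∈ symmDomain B := hsymm (ball_subset_ball (by linarith) hζ16)
  have hζB : ζ ∉ B := hζΩ.1
  have hr : 2 * stepSize S u < ‖hullExt Φ ζ‖ := by
    have := hm₀ ζ hζ; linarith
  rcases lt_trichotomy ζ.im 0 with him | him | him
  · exact phiStep_hmap_of_im_neg hB hΦ hU hU0 hu hS hρ₀ hBρ hη' hΦ' hζΩ him hr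
  · have hζre : ((ζ.re : ℝ) : ℂ) = ζ := by
      apply Complex.ext <;> simp [him]
    have halive := (alive_of_stepSize_le hU hu hS (z := ζ) (by linarith)).1
    have := phiStep_hmap_of_real hB hΦ hU hU0 hu hS hρ₀ hBρ hη' hΦ' (x := ζ.re)
      (by rwa [hζre]) (by rwa [hζre]) (by rwa [hζre])
    rwa [hζre] at this
  · exact phiStep_hmap_of_im_pos hB hΦ ⟨him, hζB⟩ _

omit hB hΦ hρ₀ hBρ in
/-- The algebraic identity behind the pointwise bound. [folklore] -/
private theorem far_algebra (Δ φh h hT hTg a E D1 gζ ζ twou : ℂ) (hconj : φh = hTg)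
    (hΔ : Δ = hT - h) :
    Δ - (a / E - D1 * (twou / ζ)) =
      (φh - h - a / E) - (hTg - hT - D1 * (gζ - ζ)) - D1 * (gζ - ζ - twou / ζ) := by
  subst hconj hΔ; ring

include hB hΦ hd hU hU0 hu hS hρ₀ hBρ hη hΦ' hr₁' hx₀ hBx hm₀ hm₀η in
/-- **The pointwise identity far from the tip** (`ζ ∈ B(x₀, 3r₁)`):
`|[h'(ζ) − h(ζ)] − [a/E_B(ζ) − E_{B'}'(ζ − U_u)·2u/ζ]| ≤ 60 d u η/m₀² + 2048 u η/ρ₀² + 196608 u²/ρ₀³`,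
`a = stepCap Φ Φ' (2η)` — the circle identity of `LoewnerImageStepCircle` at a far point, where the
lower bound for `|E_B|` is the hypothesis `m₀` instead of Koebe's `dρ/4`.
[cite: Lawler2005, §4.6.1 proof of Prop. 4.40; LawlerSchrammWerner2003Restriction, §5 (5.1)] -/
theorem norm_sub_hmap_far_le {ζ : ℂ} (hζ : ζ ∈ ball (x₀ : ℂ) (3 * r₁)) :
    ‖(hmapT Φ' (U u) ζ - hmap Φ ζ) - ((stepCap Φ Φ' (2 * stepSize S u) : ℂ) / hullExt Φ ζ -
        deriv (hullExt Φ') (ζ - U u) * (2 * (u : ℂ) / ζ))‖ ≤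
      60 * d * u * stepSize S u / m₀ ^ 2 + 2048 * u * stepSize S u / ρ₀ ^ 2 + 196608 * u ^ 2 / ρ₀ ^ 3 := by
  obtain ⟨hd0, hd1, hη0, hη1, huη, huρ⟩ := stepSize_small hB hΦ hd hu hS hρ₀ hη
  have hη' : stepSize S u ≤ ρ₀ := by linarith
  have hζ16 := ball_three_subset hr₁' hζ
  have hζn := norm_ge_of_mem_ball_far hx₀ hζ16
  have hζ0 : ζ ≠ 0 := by intro h; rw [h, norm_zero] at hζn; linarith
  have hm₀pos : 0 < m₀ := by linarith
  set a : ℝ := stepCap Φ Φ' (2 * stepSize S u) with ha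
  set η : ℝ := stepSize S u with hηdef
  have hydro := isHydrodynamicAt_phiStep hB hΦ hU hU0 hu hS hρ₀ hBρ hη' hΦ'
  have ha0 : 0 ≤ a := hydro.hcapAt_nonneg
  obtain ⟨ha5, -⟩ := stepCap_le hB hΦ hd hU hU0 hu hS hρ₀ hBρ hη hΦ'
  -- lower bound on `|E_B ζ|`
  have hEz : m₀ ≤ ‖hullExt Φ ζ‖ := hm₀ ζ hζ
  have hEpos : 0 < ‖hullExt Φ ζ‖ := lt_of_lt_of_le hm₀pos hEz
  -- the expansion of `φ` at `w = h ζ`, `w - w₀ = E ζ`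
  have hL : ((hullShift Φ).re : ℂ) = hullShift Φ := by
    apply Complex.ext <;> simp [hullShift_im hB.isBoundedHull hΦ]
  have hwx : hmap Φ ζ - (((-hullShift Φ).re : ℝ) : ℂ) = hullExt Φ ζ := by
    rw [hmap, neg_re, ofReal_neg, hL]; ring
  have h2r : 2 * (2 * η) ≤ ‖hmap Φ ζ - (((-hullShift Φ).re : ℝ) : ℂ)‖ := by
    rw [hwx]; linarith
  have hexp := hydro.norm_sub_sub_div_le' h2r
  rw [hwx] at hexp
  change ‖phiStep Φ Φ' (2 * η) (hmap Φ ζ) - hmap Φ ζ - (a : ℂ) / hullExt Φ ζ‖ ≤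
    6 * a * (2 * η) / ‖hullExt Φ ζ‖ ^ 2 at hexp
  -- conjugation, Loewner increment (`ρ₀ ↦ ρ₀/8`), Taylor
  have hconj := phiStep_hmap_far hB hΦ hd hU hU0 hu hS hρ₀ hBρ hη hΦ' hr₁' hx₀ hBx hm₀ hm₀η hζ
  obtain ⟨hLR, hmv⟩ := norm_map_sub_sub_div_le hU hu hS (ρ₀ := ρ₀ / 8) (by positivity)
    (by linarith : stepSize S u ≤ ρ₀ / 8 / 4) (ζ := ζ) (by linarith)
  have hmv' : ‖map U u ζ - ζ‖ ≤ ρ₀ / 16 := by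
    refine hmv.trans ?_
    rw [div_le_div_iff₀ (by positivity) (by norm_num)]
    nlinarith
  have hT := norm_hmapT_taylor_far_le hB hΦ hd hU hU0 hu hS hρ₀ hBρ hη hΦ' hBx hζ16 hmv'
  have hD1 : ‖deriv (hullExt Φ') (ζ - U u)‖ ≤ 2 := by
    obtain ⟨-, -, hD1', -⟩ := differentiableOn_hullExt_slid_far hB hΦ hd hU hU0 hu hS hρ₀ hBρ hη hΦ' hBx
    refine hD1' _ ?_
    have hUu : |U u| ≤ η := by
      have := hS u le_rfl; rw [hηdef, stepSize]; have := Real.sqrt_nonneg (u : ℝ); linarith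
    rw [mem_ball, dist_eq_norm] at hζ16 ⊢
    calc ‖ζ - U u - x₀‖ = ‖(ζ - x₀) - (U u : ℂ)‖ := by ring_nf
      _ ≤ ‖ζ - x₀‖ + ‖((U u : ℝ) : ℂ)‖ := norm_sub_le _ _
      _ < ρ₀ / 16 + ρ₀ / 1000 := by rw [norm_real, Real.norm_eq_abs]; linarith
      _ ≤ ρ₀ / 4 := by linarith
  rw [far_algebra _ _ _ _ _ _ _ _ (map U u ζ) ζ _ hconj rfl]
  -- the three error terms
  have e1 : ‖phiStep Φ Φ' (2 * η) (hmap Φ ζ) - hmap Φ ζ - (a : ℂ) / hullExt Φ ζ‖ ≤ 60 * d * u * η / m₀ ^ 2 := by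
    refine hexp.trans ?_
    rw [div_le_div_iff₀ (by positivity) (by positivity)]
    have hsq : m₀ ^ 2 ≤ ‖hullExt Φ ζ‖ ^ 2 := pow_le_pow_left₀ hm₀pos.le hEz 2
    have h1 : 6 * a * (2 * η) ≤ 60 * d * u * η := by nlinarith
    calc 6 * a * (2 * η) * m₀ ^ 2 ≤ 60 * d * u * η * m₀ ^ 2 := by gcongr
      _ ≤ 60 * d * u * η * ‖hullExt Φ ζ‖ ^ 2 := by gcongr
  have e2 : ‖hmapT Φ' (U u) (map U u ζ) - hmapT Φ' (U u) ζ -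
      deriv (hullExt Φ') (ζ - U u) * (map U u ζ - ζ)‖ ≤ 196608 * u ^ 2 / ρ₀ ^ 3 := by
    refine hT.trans ?_
    have := pow_le_pow_left₀ (norm_nonneg _) hmv 2
    calc 48 / ρ₀ * ‖map U u ζ - ζ‖ ^ 2 ≤ 48 / ρ₀ * (8 * u / (ρ₀ / 8)) ^ 2 :=
          mul_le_mul_of_nonneg_left this (by positivity)
      _ = 196608 * u ^ 2 / ρ₀ ^ 3 := by field_simp; ring
  have e3 : ‖deriv (hullExt Φ') (ζ - U u) * (map U u ζ - ζ - 2 * (u : ℂ) / ζ)‖ ≤ 2048 * u * η / ρ₀ ^ 2 := by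
    rw [norm_mul]
    calc _ ≤ 2 * (16 * u * stepSize S u / (ρ₀ / 8) ^ 2) := mul_le_mul hD1 hLR (norm_nonneg _) (by norm_num)
      _ = 2048 * u * η / ρ₀ ^ 2 := by rw [hηdef]; field_simp; ring
  calc _ ≤ ‖phiStep Φ Φ' (2 * η) (hmap Φ ζ) - hmap Φ ζ - (a : ℂ) / hullExt Φ ζ -
          (hmapT Φ' (U u) (map U u ζ) - hmapT Φ' (U u) ζ - deriv (hullExt Φ') (ζ - U u) * (map U u ζ - ζ))‖ +
        ‖deriv (hullExt Φ') (ζ - U u) * (map U u ζ - ζ - 2 * (u : ℂ) / ζ)‖ := norm_sub_le _ _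
    _ ≤ (60 * d * u * η / m₀ ^ 2 + 196608 * u ^ 2 / ρ₀ ^ 3) + 2048 * u * η / ρ₀ ^ 2 := by
        gcongr
        exact (norm_sub_le _ _).trans (add_le_add e1 e2)
    _ = _ := by ring

/-! ### `|h' − h| ≤ K u` far from the tip, and the derivative by Cauchy -/

/-- The constant of the crude bound `|h' − h| ≤ K u` on `B(x₀, 3r₁)`. [folklore] -/
def farCrude (d ρ₀ m₀ : ℝ) : ℝ := 5 * d / m₀ + 67 / ρ₀ + d * ρ₀ / m₀ ^ 2

include hB hΦ hd hU hU0 hu hS hρ₀ hBρ hη hΦ' hr₁' hx₀ hBx hm₀ hm₀η in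
/-- **`|h'(ζ) − h(ζ)| ≤ farCrude · u` on `B(x₀, 3r₁)`** (`a ≤ 5du`, `|E_B| ≥ m₀`, `|E_{B'}'| ≤ 2`,
`|ζ| ≥ ρ₀/16`, `η ≤ ρ₀/1000`, `u ≤ ρ₀²/10⁶`). [cite: LawlerSchrammWerner2003Restriction, §5 (5.1)] -/
theorem norm_hmapT_sub_hmap_far_le {ζ : ℂ} (hζ : ζ ∈ ball (x₀ : ℂ) (3 * r₁)) :
    ‖hmapT Φ' (U u) ζ - hmap Φ ζ‖ ≤ farCrude d ρ₀ m₀ * u := by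
  obtain ⟨hd0, hd1, hη0, hη1, huη, huρ⟩ := stepSize_small hB hΦ hd hu hS hρ₀ hη
  have hkey := norm_sub_hmap_far_le hB hΦ hd hU hU0 hu hS hρ₀ hBρ hη hΦ' hr₁' hx₀ hBx hm₀ hm₀η hζ
  obtain ⟨ha5, -⟩ := stepCap_le hB hΦ hd hU hU0 hu hS hρ₀ hBρ hη hΦ'
  have hζ16 := ball_three_subset hr₁' hζ
  have hζn := norm_ge_of_mem_ball_far hx₀ hζ16
  have hζ0 : ζ ≠ 0 := by intro h; rw [h, norm_zero] at hζn; linarith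
  have hm₀pos : 0 < m₀ := by linarith
  set a : ℝ := stepCap Φ Φ' (2 * stepSize S u) with ha
  set η : ℝ := stepSize S u with hηdef
  have ha0 : 0 ≤ a := (isHydrodynamicAt_phiStep hB hΦ hU hU0 hu hS hρ₀ hBρ (by linarith) hΦ').hcapAt_nonneg
  have hEz : m₀ ≤ ‖hullExt Φ ζ‖ := hm₀ ζ hζ
  have hEpos : 0 < ‖hullExt Φ ζ‖ := lt_of_lt_of_le hm₀pos hEz
  have hD1 : ‖deriv (hullExt Φ') (ζ - U u)‖ ≤ 2 := by
    obtain ⟨-, -, hD1', -⟩ := differentiableOn_hullExt_slid_far hB hΦ hd hU hU0 hu hS hρ₀ hBρ hη hΦ' hBx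
    refine hD1' _ ?_
    have hUu : |U u| ≤ η := by
      have := hS u le_rfl; rw [hηdef, stepSize]; have := Real.sqrt_nonneg (u : ℝ); linarith
    rw [mem_ball, dist_eq_norm] at hζ16 ⊢
    calc ‖ζ - U u - x₀‖ = ‖(ζ - x₀) - (U u : ℂ)‖ := by ring_nf
      _ ≤ ‖ζ - x₀‖ + ‖((U u : ℝ) : ℂ)‖ := norm_sub_le _ _
      _ < ρ₀ / 16 + ρ₀ / 1000 := by rw [norm_real, Real.norm_eq_abs]; linarith
      _ ≤ ρ₀ / 4 := by linarith
  -- the two explicit terms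
  have t1 : ‖(a : ℂ) / hullExt Φ ζ‖ ≤ 5 * d * u / m₀ := by
    rw [norm_div, norm_real, Real.norm_of_nonneg ha0]
    exact div_le_div₀ (by positivity) ha5 hm₀pos hEz
  have t2 : ‖deriv (hullExt Φ') (ζ - U u) * (2 * (u : ℂ) / ζ)‖ ≤ 64 * u / ρ₀ := by
    rw [norm_mul, norm_div, norm_mul, Complex.norm_two, Complex.norm_of_nonneg u.coe_nonneg]
    calc ‖deriv (hullExt Φ') (ζ - U u)‖ * (2 * u / ‖ζ‖) ≤ 2 * (2 * u / (ρ₀ / 16)) := by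
          gcongr
      _ = 64 * u / ρ₀ := by field_simp; ring
  -- the remainder is `≤ 3u/ρ₀` by the smallness of `η` and `u`
  have r1 : 60 * d * u * η / m₀ ^ 2 ≤ d * ρ₀ / m₀ ^ 2 * u := by
    rw [div_le_iff₀ (by positivity)]
    have : d * ρ₀ / m₀ ^ 2 * u * m₀ ^ 2 = d * ρ₀ * u := by field_simp
    rw [this]
    have : 60 * η ≤ ρ₀ := by linarith
    nlinarith [u.coe_nonneg, hd0.le]
  have r2 : 2048 * u * η / ρ₀ ^ 2 ≤ 2.048 / ρ₀ * u := by
    rw [div_le_iff₀ (by positivity)]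
    have : 2.048 / ρ₀ * u * ρ₀ ^ 2 = 2.048 * u * ρ₀ := by field_simp
    rw [this]
    nlinarith [u.coe_nonneg]
  have r3 : 196608 * u ^ 2 / ρ₀ ^ 3 ≤ 0.196608 / ρ₀ * u := by
    rw [div_le_iff₀ (by positivity)]
    have : 0.196608 / ρ₀ * u * ρ₀ ^ 3 = 0.196608 * u * ρ₀ ^ 2 := by field_simp
    rw [this]
    have := mul_le_mul_of_nonneg_left huρ (by positivity : (0 : ℝ) ≤ 196608 * u)
    nlinarith [u.coe_nonneg]
  have hmain := norm_le_norm_add_norm_sub (((a : ℂ)) / hullExt Φ ζ - deriv (hullExt Φ') (ζ - U u) * (2 * (u : ℂ) / ζ))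
    (hmapT Φ' (U u) ζ - hmap Φ ζ)
  rw [norm_sub_rev ((a : ℂ) / hullExt Φ ζ - _)] at hmain
  have hAB : ‖(a : ℂ) / hullExt Φ ζ - deriv (hullExt Φ') (ζ - U u) * (2 * (u : ℂ) / ζ)‖ ≤ 5 * d * u / m₀ + 64 * u / ρ₀ :=
    (norm_sub_le _ _).trans (add_le_add t1 t2)
  unfold farCrude
  have hsum : 5 * d * u / m₀ + 64 * u / ρ₀ + (d * ρ₀ / m₀ ^ 2 * u + 2.048 / ρ₀ * u + 0.196608 / ρ₀ * u) ≤
      (5 * d / m₀ + 67 / ρ₀ + d * ρ₀ / m₀ ^ 2) * u := by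
    have hu0 : (0 : ℝ) ≤ u := u.coe_nonneg
    have : 5 * d * u / m₀ + 64 * u / ρ₀ + (d * ρ₀ / m₀ ^ 2 * u + 2.048 / ρ₀ * u + 0.196608 / ρ₀ * u) =
        (5 * d / m₀ + 66.244608 / ρ₀ + d * ρ₀ / m₀ ^ 2) * u := by ring
    rw [this]
    gcongr
    norm_num
  linarith [hmain, hAB, hkey, r1, r2, r3, hsum]

include hB hΦ hd hU hU0 hu hS hρ₀ hBρ hη hΦ' hBx in
/-- `h' − h` is holomorphic on `B(x₀, ρ₀/4)`, with derivative `E_{B'}'(z − U_u) − E_B'(z)`. [folklore] -/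
theorem hasDerivAt_hmapT_sub_hmap_far {z : ℂ} (hz : z ∈ ball (x₀ : ℂ) (ρ₀ / 4)) :
    HasDerivAt (fun w ↦ hmapT Φ' (U u) w - hmap Φ w)
      (deriv (hullExt Φ') (z - U u) - deriv (hullExt Φ) z) z := by
  obtain ⟨-, hE, -⟩ := differentiableOn_hullExt_far hB hΦ hBx
  have h1 := hasDerivAt_hmapT_far hB hΦ hd hU hU0 hu hS hρ₀ hBρ hη hΦ' hBx hz
  have h2 : HasDerivAt (hmap Φ) (deriv (hullExt Φ) z) z :=
    ((hE.differentiableAt (isOpen_ball.mem_nhds (ball_subset_ball (by linarith) hz))).hasDerivAt).sub_const _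
  exact h1.sub h2

include hB hΦ hd hU hU0 hu hS hρ₀ hBρ hη hΦ' hr₁ hr₁' hx₀ hBx hm₀ hm₀η in
/-- **`|(h' − h)'(z)| ≤ 2 farCrude u/r₁` on `closedBall x₀ (2r₁)`** (Cauchy on `ball z r₁ ⊆ B(x₀, 3r₁)`):
`|E_{B'}'(z − U_u) − E_B'(z)| ≤ 2 farCrude u/r₁`. [cite: LawlerSchrammWerner2003Restriction, §5 (5.1)] -/
theorem norm_deriv_hmapT_sub_hmap_far_le {z : ℂ} (hz : z ∈ closedBall (x₀ : ℂ) (2 * r₁)) :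
    ‖deriv (hullExt Φ') (z - U u) - deriv (hullExt Φ) z‖ ≤ 2 * (farCrude d ρ₀ m₀ * u) / r₁ := by
  have hsub : ball z r₁ ⊆ ball (x₀ : ℂ) (3 * r₁) := by
    intro w hw
    rw [mem_ball] at hw ⊢; rw [mem_closedBall] at hz
    linarith [dist_triangle w z x₀]
  have hsub4 : ball (x₀ : ℂ) (3 * r₁) ⊆ ball (x₀ : ℂ) (ρ₀ / 4) := ball_subset_ball (by linarith)
  have hD : DifferentiableOn ℂ (fun w ↦ hmapT Φ' (U u) w - hmap Φ w) (ball z r₁) := fun w hw ↦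
    (hasDerivAt_hmapT_sub_hmap_far hB hΦ hd hU hU0 hu hS hρ₀ hBρ hη hΦ' hBx (hsub4 (hsub hw))).differentiableAt.differentiableWithinAt
  have h := norm_deriv_le_of_forall_mem_ball hr₁ hD fun w hw ↦
    norm_hmapT_sub_hmap_far_le hB hΦ hd hU hU0 hu hS hρ₀ hBρ hη hΦ' hr₁' hx₀ hBx hm₀ hm₀η (hsub hw)
  rwa [(hasDerivAt_hmapT_sub_hmap_far hB hΦ hd hU hU0 hu hS hρ₀ hBρ hη hΦ' hBx
    (hsub4 (hsub (mem_ball_self hr₁)))).deriv] at h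

/-! ### Feeding back: `h' − h = 2u (d²/E_B − E_B'/z) + O(u(η + u))` far from the tip -/

/-- The `η`-coefficient of the far remainder. [folklore] -/
def farC₁ (d ρ₀ m₀ : ℝ) : ℝ := 60 * d / m₀ ^ 2 + 2048 / ρ₀ ^ 2 + 1000 / (ρ₀ * m₀)

/-- The `u`-coefficient of the far remainder. [folklore] -/
def farC₂ (d ρ₀ m₀ r₁ : ℝ) : ℝ := 196608 / ρ₀ ^ 3 + 228 / (ρ₀ ^ 2 * m₀) + 64 * farCrude d ρ₀ m₀ / (r₁ * ρ₀)

include hB hΦ hd hU hU0 hu hS hρ₀ hBρ hη hΦ' in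
/-- **`a = 2 d² u + O(u(η + u))`**: `|a − 2ud²| ≤ u (1000 η/ρ₀ + 228 u/ρ₀²)`, from
`|a/d − 2u E_{B'}'(−U_u)| ≤ u(1000η/(dρ₀) + 128u/ρ₀²)` (`stepCap_le`) and
`|E_{B'}'(−U_u) − E_B'(0)| ≤ 50u/ρ₀²` (`norm_deriv_hmapT_sub_hmap_le` at `0`), `E_B'(0) = d`.
[cite: Lawler2005, §4.6.1 (4.15) with Prop. 4.40] -/
theorem norm_stepCap_sub_le :
    ‖(stepCap Φ Φ' (2 * stepSize S u) : ℂ) - 2 * (u : ℂ) * d ^ 2‖ ≤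
      u * (1000 * stepSize S u / ρ₀ + 228 * u / ρ₀ ^ 2) := by
  obtain ⟨hd0, hd1, hη0, hη1, huη, huρ⟩ := stepSize_small hB hΦ hd hu hS hρ₀ hη
  obtain ⟨-, hkey⟩ := stepCap_le hB hΦ hd hU hU0 hu hS hρ₀ hBρ hη hΦ'
  have hder := norm_deriv_hmapT_sub_hmap_le hB hΦ hd hU hU0 hu hS hρ₀ hBρ hη hΦ' (z := 0) (by simp; linarith)
  rw [zero_sub, deriv_hullExt_zero hB hΦ hd] at hder
  set a : ℝ := stepCap Φ Φ' (2 * stepSize S u) with ha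
  set η : ℝ := stepSize S u with hηdef
  set D := deriv (hullExt Φ') (-(U u : ℂ)) with hD
  have hsplit : (a : ℂ) - 2 * (u : ℂ) * d ^ 2 = (d : ℂ) * ((a : ℂ) / d - 2 * (u : ℂ) * D) + 2 * (u : ℂ) * d * (D - d) := by
    field_simp [hd0.ne']
    ring
  rw [hsplit]
  have n1 : ‖(d : ℂ) * ((a : ℂ) / d - 2 * (u : ℂ) * D)‖ ≤ d * (u * (1000 * η / (d * ρ₀) + 128 * u / ρ₀ ^ 2)) := by
    rw [norm_mul, norm_real, Real.norm_of_nonneg hd0.le]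
    exact mul_le_mul_of_nonneg_left hkey hd0.le
  have n2 : ‖2 * (u : ℂ) * d * (D - d)‖ ≤ 2 * u * d * (50 * u / ρ₀ ^ 2) := by
    rw [norm_mul, norm_mul, norm_mul, Complex.norm_two, Complex.norm_of_nonneg u.coe_nonneg, norm_real,
      Real.norm_of_nonneg hd0.le]
    exact mul_le_mul_of_nonneg_left hder (by positivity)
  calc _ ≤ ‖(d : ℂ) * ((a : ℂ) / d - 2 * (u : ℂ) * D)‖ + ‖2 * (u : ℂ) * d * (D - d)‖ := norm_add_le _ _
    _ ≤ d * (u * (1000 * η / (d * ρ₀) + 128 * u / ρ₀ ^ 2)) + 2 * u * d * (50 * u / ρ₀ ^ 2) := add_le_add n1 n2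
    _ = u * (1000 * η / ρ₀ + 228 * d * (u / ρ₀ ^ 2)) := by field_simp; ring
    _ ≤ u * (1000 * η / ρ₀ + 228 * 1 * (u / ρ₀ ^ 2)) := by gcongr
    _ = u * (1000 * η / ρ₀ + 228 * u / ρ₀ ^ 2) := by ring

include hB hΦ hd hU hU0 hu hS hρ₀ hBρ hη hΦ' hr₁ hr₁' hx₀ hBx hm₀ hm₀η in
/-- **The first-order expansion of `h' − h` far from the tip** ([LSW] (5.1) in one-step form at the
force point): for `ζ ∈ closedBall x₀ r₁`,
`|h'(ζ) − h(ζ) − 2u (d²/E_B(ζ) − E_B'(ζ)/ζ)| ≤ u (farC₁ η + farC₂ u)`.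
[cite: LawlerSchrammWerner2003Restriction, §5 (5.1) and §8.4 proof of Lemma 8.9 (d[h_t(O_t)])] -/
theorem norm_hmapT_sub_hmap_sub_far_le {ζ : ℂ} (hζ : ζ ∈ closedBall (x₀ : ℂ) r₁) :
    ‖hmapT Φ' (U u) ζ - hmap Φ ζ -
        2 * (u : ℂ) * ((d : ℂ) ^ 2 / hullExt Φ ζ - deriv (hullExt Φ) ζ / ζ)‖ ≤
      u * (farC₁ d ρ₀ m₀ * stepSize S u + farC₂ d ρ₀ m₀ r₁ * u) := by
  obtain ⟨hd0, hd1, hη0, hη1, huη, huρ⟩ := stepSize_small hB hΦ hd hu hS hρ₀ hη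
  have hζ3 : ζ ∈ ball (x₀ : ℂ) (3 * r₁) := by
    rw [mem_closedBall] at hζ; rw [mem_ball]; linarith
  have hζ2 : ζ ∈ closedBall (x₀ : ℂ) (2 * r₁) := by
    rw [mem_closedBall] at hζ ⊢; linarith
  have hζ16 := ball_three_subset hr₁' hζ3
  have hζn := norm_ge_of_mem_ball_far hx₀ hζ16
  have hζ0 : ζ ≠ 0 := by intro h; rw [h, norm_zero] at hζn; linarith
  have hm₀pos : 0 < m₀ := by linarith
  have hEz : m₀ ≤ ‖hullExt Φ ζ‖ := hm₀ ζ hζ3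
  have hEpos : 0 < ‖hullExt Φ ζ‖ := lt_of_lt_of_le hm₀pos hEz
  have hkey := norm_sub_hmap_far_le hB hΦ hd hU hU0 hu hS hρ₀ hBρ hη hΦ' hr₁' hx₀ hBx hm₀ hm₀η hζ3
  have hcap := norm_stepCap_sub_le hB hΦ hd hU hU0 hu hS hρ₀ hBρ hη hΦ'
  have hder := norm_deriv_hmapT_sub_hmap_far_le hB hΦ hd hU hU0 hu hS hρ₀ hBρ hη hΦ' hr₁ hr₁' hx₀ hBx hm₀ hm₀η hζ2
  set a : ℝ := stepCap Φ Φ' (2 * stepSize S u) with ha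
  set η : ℝ := stepSize S u with hηdef
  set E := hullExt Φ ζ with hE
  set D1 := deriv (hullExt Φ') (ζ - U u) with hD1
  set D0 := deriv (hullExt Φ) ζ with hD0
  set Δ := hmapT Φ' (U u) ζ - hmap Φ ζ with hΔ
  have hsplit : Δ - 2 * (u : ℂ) * ((d : ℂ) ^ 2 / E - D0 / ζ) =
      (Δ - ((a : ℂ) / E - D1 * (2 * (u : ℂ) / ζ))) + ((a : ℂ) - 2 * (u : ℂ) * d ^ 2) / E -
        (D1 - D0) * (2 * (u : ℂ) / ζ) := by
    field_simp
    ring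
  rw [hsplit]
  have n2 : ‖((a : ℂ) - 2 * (u : ℂ) * d ^ 2) / E‖ ≤ u * (1000 * η / ρ₀ + 228 * u / ρ₀ ^ 2) / m₀ := by
    rw [norm_div]
    exact div_le_div₀ (by positivity) hcap hm₀pos hEz
  have n3 : ‖(D1 - D0) * (2 * (u : ℂ) / ζ)‖ ≤ 2 * (farCrude d ρ₀ m₀ * u) / r₁ * (2 * u / (ρ₀ / 16)) := by
    rw [norm_mul, norm_div, norm_mul, Complex.norm_two, Complex.norm_of_nonneg u.coe_nonneg]
    have hcr : 0 ≤ farCrude d ρ₀ m₀ := by unfold farCrude; positivity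
    gcongr
  calc _ ≤ ‖Δ - ((a : ℂ) / E - D1 * (2 * (u : ℂ) / ζ))‖ + ‖((a : ℂ) - 2 * (u : ℂ) * d ^ 2) / E‖ +
        ‖(D1 - D0) * (2 * (u : ℂ) / ζ)‖ := norm_add_sub_le_aux _ _ _
    _ ≤ (60 * d * u * η / m₀ ^ 2 + 2048 * u * η / ρ₀ ^ 2 + 196608 * u ^ 2 / ρ₀ ^ 3) +
        u * (1000 * η / ρ₀ + 228 * u / ρ₀ ^ 2) / m₀ + 2 * (farCrude d ρ₀ m₀ * u) / r₁ * (2 * u / (ρ₀ / 16)) :=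
          add_le_add (add_le_add hkey n2) n3
    _ = u * (farC₁ d ρ₀ m₀ * η + farC₂ d ρ₀ m₀ r₁ * u) := by
        unfold farC₁ farC₂; field_simp; ring
where
  /-- `‖x + y − z‖ ≤ ‖x‖ + ‖y‖ + ‖z‖`. -/
  norm_add_sub_le_aux (x y z : ℂ) : ‖x + y - z‖ ≤ ‖x‖ + ‖y‖ + ‖z‖ :=
    (norm_sub_le _ _).trans (add_le_add (norm_add_le _ _) le_rfl)

include hB hΦ hd hU hU0 hu hS hρ₀ hBρ hη hΦ' hr₁ hr₁' hx₀ hBx hm₀ hm₀η in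
/-- **The derivative form at the centre**: with `D̃(z) = d²/E_B(z) − E_B'(z)/z`,
`|(h' − h)'(x₀) − 2u D̃'(x₀)| ≤ 2 u (farC₁ η + farC₂ u)/r₁`, i.e.
`E_{B'}'(x₀ − U_u) − E_B'(x₀) = 2u D̃'(x₀) + O(u(η + u))` — the one-step form of the displayed
`d[h_t'(O_t)]` of [LSW] (Cauchy on `ball x₀ r₁` for the holomorphic remainder).
[cite: LawlerSchrammWerner2003Restriction, §8.4 proof of Lemma 8.9 (d[h_t'(O_t)])] -/
theorem norm_deriv_hmapT_sub_hmap_sub_far_le :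
    ‖(deriv (hullExt Φ') (x₀ - U u) - deriv (hullExt Φ) x₀) -
        2 * (u : ℂ) * deriv (fun z ↦ (d : ℂ) ^ 2 / hullExt Φ z - deriv (hullExt Φ) z / z) x₀‖ ≤
      2 * (u * (farC₁ d ρ₀ m₀ * stepSize S u + farC₂ d ρ₀ m₀ r₁ * u)) / r₁ := by
  obtain ⟨hd0, hd1, hη0, hη1, huη, huρ⟩ := stepSize_small hB hΦ hd hu hS hρ₀ hη
  obtain ⟨-, hE, -⟩ := differentiableOn_hullExt_far hB hΦ hBx
  have hm₀pos : 0 < m₀ := by linarith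
  -- the remainder function is holomorphic on `ball x₀ r₁`
  set Dt : ℂ → ℂ := fun z ↦ (d : ℂ) ^ 2 / hullExt Φ z - deriv (hullExt Φ) z / z with hDt
  set R : ℂ → ℂ := fun z ↦ (hmapT Φ' (U u) z - hmap Φ z) - 2 * (u : ℂ) * Dt z with hR
  have hsub3 : ball (x₀ : ℂ) r₁ ⊆ ball (x₀ : ℂ) (3 * r₁) := ball_subset_ball (by linarith)
  have hsub4 : ball (x₀ : ℂ) (3 * r₁) ⊆ ball (x₀ : ℂ) (ρ₀ / 4) := ball_subset_ball (by linarith)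
  have hne : ∀ z ∈ ball (x₀ : ℂ) (3 * r₁), z ≠ 0 ∧ hullExt Φ z ≠ 0 := fun z hz ↦ by
    have hzn := norm_ge_of_mem_ball_far hx₀ (ball_three_subset hr₁' hz)
    refine ⟨fun h ↦ ?_, fun h ↦ ?_⟩
    · rw [h, norm_zero] at hzn; linarith
    · have := hm₀ z hz; rw [h, norm_zero] at this; linarith
  have hE' : DifferentiableOn ℂ (deriv (hullExt Φ)) (ball (x₀ : ℂ) ρ₀) :=
    ((hE.analyticOnNhd isOpen_ball).deriv).differentiableOn
  have hDtd : DifferentiableOn ℂ Dt (ball (x₀ : ℂ) (3 * r₁)) := by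
    have hEr := hE.mono (hsub4.trans (ball_subset_ball (by linarith)))
    have hE'r := hE'.mono (hsub4.trans (ball_subset_ball (by linarith)))
    exact ((differentiableOn_const _).div hEr fun z hz ↦ (hne z hz).2).sub
      (hE'r.div differentiableOn_id fun z hz ↦ (hne z hz).1)
  have hΔd : DifferentiableOn ℂ (fun w ↦ hmapT Φ' (U u) w - hmap Φ w) (ball (x₀ : ℂ) (3 * r₁)) := fun w hw ↦
    (hasDerivAt_hmapT_sub_hmap_far hB hΦ hd hU hU0 hu hS hρ₀ hBρ hη hΦ' hBx (hsub4 hw)).differentiableAt.differentiableWithinAt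
  have hRd : DifferentiableOn ℂ R (ball (x₀ : ℂ) r₁) := (hΔd.sub (hDtd.const_mul _)).mono hsub3
  have hRM : ∀ z ∈ ball (x₀ : ℂ) r₁, ‖R z‖ ≤ u * (farC₁ d ρ₀ m₀ * stepSize S u + farC₂ d ρ₀ m₀ r₁ * u) :=
    fun z hz ↦ norm_hmapT_sub_hmap_sub_far_le hB hΦ hd hU hU0 hu hS hρ₀ hBρ hη hΦ' hr₁ hr₁' hx₀ hBx hm₀ hm₀η
      (ball_subset_closedBall hz)
  have h := norm_deriv_le_of_forall_mem_ball hr₁ hRd hRM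
  -- identify `deriv R x₀`
  have hx3 : (x₀ : ℂ) ∈ ball (x₀ : ℂ) (3 * r₁) := mem_ball_self (by linarith)
  have hΔ' := hasDerivAt_hmapT_sub_hmap_far hB hΦ hd hU hU0 hu hS hρ₀ hBρ hη hΦ' hBx (hsub4 hx3)
  have hDt' : HasDerivAt Dt (deriv Dt x₀) x₀ :=
    (hDtd.differentiableAt (isOpen_ball.mem_nhds hx3)).hasDerivAt
  have hR' : HasDerivAt R ((deriv (hullExt Φ') (x₀ - U u) - deriv (hullExt Φ) x₀) - 2 * (u : ℂ) * deriv Dt x₀) x₀ :=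
    hΔ'.sub (hDt'.const_mul _)
  rwa [hR'.deriv] at h

end Loewner

end Literature.Probability.RandomPlanarGeometry
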